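import Mathlib
import Summits.SmoothPoincare4.SmoothPoincare4.Theorems.SullivanDualWitnessChargeHelperFlatZalcman

/-!
# Auxiliary lemmas for `helper_gradBoundOfC0_of` (Zalcman upgrade), crux `WitnessCharge`
(item stmt-SmoothPoincare4-7824, route `SullivanDual`, line `Sketch`; registered stub of this
file: `helper_gradBoundOfC0_zalcman`)

Generic (target a real normed space `E`) ingredients of the Zalcman–Brody blow-up argument
proving that `C⁰_loc` convergence of flat-`J`-holomorphic maps forces local gradient bounds:

* local chain rule for real affine reparametrisations `η ↦ f (ξ + ρ • η)` of the source
  (`GradBound.hasFDerivAt_comp_affine` and consequences; flat `J`-holomorphicity on an open set is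
  preserved, `GradBound.jHol_comp_affine`);
* **Zalcman–Brody rescaling with domain control** (`helper_gradBoundOfC0_zalcman`): the proof of
  the landed `helper_flatZalcman` (L. Zalcman, Amer. Math. Monthly 82 (1975); R. Brody, Trans. AMS
  235 (1978)) for maps that are only `C¹` on the disc `‖z‖ < 2`, recording moreover that
  `ρ M ≤ 1` and that the disc `‖ζ‖ ≤ M / 2` is mapped by `ζ ↦ ξ₀ + ρ ζ` into the disc of radius
  `(1 + ‖ξ₀‖) / 2 < 1`;
* uniform bounds for uniformly convergent sequences of continuous functions on compact sets,
  reindexing along `n_j → ∞`, and uniform convergence TO A CONSTANT of shrinking rescalings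
  `ζ ↦ F k (q k + t k • ζ)` (`t k → 0`, `q k → q⋆`) of a uniformly convergent sequence.
-/

noncomputable section

set_option linter.dupNamespace false

open scoped ContDiff Topology
open Filter Set Metric
open Summit.SmoothPoincare4.SmoothPoincare4.Cruxes.TameOrBrodyR4.Sketch

namespace Summit.SmoothPoincare4.SmoothPoincare4.Theorems.WitnessCharge.PencilIncompleteness

section Affine

variable {E : Type*} [NormedAddCommGroup E] [NormedSpace ℝ E]

/-- Local chain rule for a real affine reparametrisation of the source: if `f` is differentiable
at `ξ + ρ • ζ`, then `η ↦ f (ξ + ρ • η)` has derivative `ρ • df(ξ + ρ • ζ)` at `ζ`. -/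
theorem GradBound.hasFDerivAt_comp_affine {f : ℂ → E} {ξ : ℂ} {ρ : ℝ} {ζ : ℂ}
    (hf : DifferentiableAt ℝ f (ξ + ρ • ζ)) :
    HasFDerivAt (fun η : ℂ => f (ξ + ρ • η)) (ρ • fderiv ℝ f (ξ + ρ • ζ)) ζ := by
  have haff : HasFDerivAt (fun η : ℂ => ξ + ρ • η) (ρ • ContinuousLinearMap.id ℝ ℂ) ζ :=
    ((hasFDerivAt_id ζ).const_smul ρ).const_add ξ
  have hlin : (fderiv ℝ f (ξ + ρ • ζ)).comp (ρ • ContinuousLinearMap.id ℝ ℂ) =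
      ρ • fderiv ℝ f (ξ + ρ • ζ) := by
    ext η
    simp
  have hcomp := hf.hasFDerivAt.comp ζ haff
  rw [hlin] at hcomp
  exact hcomp

/-- Local form of the derivative of the affine reparametrisation `η ↦ f (ξ + ρ • η)`. -/
theorem GradBound.fderiv_comp_affine {f : ℂ → E} {ξ : ℂ} {ρ : ℝ} {ζ : ℂ}
    (hf : DifferentiableAt ℝ f (ξ + ρ • ζ)) :
    fderiv ℝ (fun η : ℂ => f (ξ + ρ • η)) ζ = ρ • fderiv ℝ f (ξ + ρ • ζ) :=
  (GradBound.hasFDerivAt_comp_affine hf).fderiv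

/-- Local form of the norm of the derivative of the affine reparametrisation, for `ρ ≥ 0`. -/
theorem GradBound.norm_fderiv_comp_affine {f : ℂ → E} {ξ : ℂ} {ρ : ℝ} {ζ : ℂ}
    (hf : DifferentiableAt ℝ f (ξ + ρ • ζ)) (hρ : 0 ≤ ρ) :
    ‖fderiv ℝ (fun η : ℂ => f (ξ + ρ • η)) ζ‖ = ρ * ‖fderiv ℝ f (ξ + ρ • ζ)‖ := by
  rw [GradBound.fderiv_comp_affine hf, norm_smul, Real.norm_of_nonneg hρ]

/-- An affine reparametrisation of a map that is `C^N` on `U` is `C^N` on every set mapped into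
`U`. -/
theorem GradBound.contDiffOn_comp_affine {u : ℂ → E} {U V : Set ℂ} {N : WithTop ℕ∞}
    (hu : ContDiffOn ℝ N u U) (c : ℂ) (t : ℝ) (hV : MapsTo (fun η : ℂ => c + t • η) V U) :
    ContDiffOn ℝ N (fun η : ℂ => u (c + t • η)) V :=
  hu.comp (contDiff_const.add (contDiff_const_smul t)).contDiffOn hV

/-- Derivative of an affine reparametrisation of a map differentiable on an open `U`, at a point
mapped into `U`. -/
theorem GradBound.fderiv_comp_affine_of_mem {u : ℂ → E} {U : Set ℂ} (hU : IsOpen U)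
    (hu : DifferentiableOn ℝ u U) (c : ℂ) (t : ℝ) {η : ℂ} (hη : c + t • η ∈ U) :
    fderiv ℝ (fun θ : ℂ => u (c + t • θ)) η = t • fderiv ℝ u (c + t • η) :=
  GradBound.fderiv_comp_affine (hu.differentiableAt (hU.mem_nhds hη))

/-- A real affine reparametrisation of the source preserves flat `J`-holomorphicity (each `J x`
is linear, so it commutes with the real scalar `t`). -/
theorem GradBound.jHol_comp_affine {J : E → E →L[ℝ] E} {u : ℂ → E} {U V : Set ℂ}
    (hU : IsOpen U) (hu : DifferentiableOn ℝ u U)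
    (huJ : ∀ z ∈ U, ∀ ζ : ℂ, fderiv ℝ u z (Complex.I * ζ) = J (u z) (fderiv ℝ u z ζ))
    (c : ℂ) (t : ℝ) (hV : MapsTo (fun η : ℂ => c + t • η) V U) :
    ∀ η ∈ V, ∀ ζ : ℂ, fderiv ℝ (fun θ : ℂ => u (c + t • θ)) η (Complex.I * ζ) =
      J (u (c + t • η)) (fderiv ℝ (fun θ : ℂ => u (c + t • θ)) η ζ) := by
  intro η hη ζ
  rw [GradBound.fderiv_comp_affine_of_mem hU hu c t (hV hη), smul_apply, smul_apply, huJ _ (hV hη),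
    (J _).map_smul]

end Affine

/-- **Zalcman–Brody rescaling with domain control.** A map `f : ℂ → E` into a real normed space,
`C¹` on the disc `‖z‖ < 2` and with `df(0) ≠ 0`, admits a centre `ξ₀` with `‖ξ₀‖ < 1`, a scale
`ρ > 0` and a radius parameter `M ≥ ‖df(0)‖` with `ρ M ≤ 1` such that the affine
reparametrisation `g = f(ξ₀ + ρ ·)` is normalised by `‖dg(0)‖ = 1`, satisfies `‖dg(ζ)‖ ≤ 2` on the
disc `‖ζ‖ ≤ M / 2`, and this disc is mapped by `ζ ↦ ξ₀ + ρ ζ` into the disc of radius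
`(1 + ‖ξ₀‖) / 2 < 1`.  Here `ξ₀` maximises `φ(ξ) = (1 - ‖ξ‖) ‖df(ξ)‖` over the closed unit disc,
`M = φ(ξ₀)` and `ρ = ‖df(ξ₀)‖⁻¹` (Zalcman 1975; Brody 1978); the proof is that of
`helper_flatZalcman`, recording the two extra pieces of information. -/
theorem helper_gradBoundOfC0_zalcman :
    ∀ {E : Type} [NormedAddCommGroup E] [NormedSpace ℝ E] (f : ℂ → E),
      ContDiffOn ℝ 1 f (Metric.ball 0 2) → fderiv ℝ f 0 ≠ 0 →
      ∃ (ξ₀ : ℂ) (ρ M : ℝ), 0 < ρ ∧ ‖ξ₀‖ < 1 ∧ ‖fderiv ℝ f 0‖ ≤ M ∧ ρ * M ≤ 1 ∧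
        (∀ ζ : ℂ, ‖ζ‖ ≤ M / 2 → ‖ξ₀ + ρ • ζ‖ ≤ (1 + ‖ξ₀‖) / 2) ∧
        ‖fderiv ℝ (fun ζ : ℂ => f (ξ₀ + ρ • ζ)) 0‖ = 1 ∧
        (∀ ζ : ℂ, ‖ζ‖ ≤ M / 2 → ‖fderiv ℝ (fun ζ : ℂ => f (ξ₀ + ρ • ζ)) ζ‖ ≤ 2) := by
  intro E _ _ f hf h0
  have hsub : closedBall (0 : ℂ) 1 ⊆ ball 0 2 := closedBall_subset_ball (by norm_num)
  have hdiff : ∀ w : ℂ, ‖w‖ ≤ 1 → DifferentiableAt ℝ f w := fun w hw =>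
    (hf.differentiableOn one_ne_zero).differentiableAt
      (isOpen_ball.mem_nhds (hsub (mem_closedBall_zero_iff.mpr hw)))
  -- the weighted derivative `φ ξ = (1 - ‖ξ‖) ‖df ξ‖` is continuous on the closed disc; maximise it
  have hφc : ContinuousOn (fun ξ : ℂ => (1 - ‖ξ‖) * ‖fderiv ℝ f ξ‖) (closedBall 0 1) :=
    (continuous_const.sub continuous_norm).continuousOn.mul
      ((hf.continuousOn_fderiv_of_isOpen isOpen_ball le_rfl).mono hsub).norm
  obtain ⟨ξ₀, hξ₀, hmax⟩ := (isCompact_closedBall (0 : ℂ) 1).exists_isMaxOn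
    ⟨0, mem_closedBall_self zero_le_one⟩ hφc
  rw [isMaxOn_iff] at hmax
  rw [mem_closedBall_zero_iff] at hξ₀
  -- abbreviations: `a = 1 - ‖ξ₀‖`, `D = ‖df ξ₀‖`, `M = a * D`, `ρ = D⁻¹`
  obtain ⟨a, ha⟩ : ∃ a : ℝ, a = 1 - ‖ξ₀‖ := ⟨_, rfl⟩
  obtain ⟨D, hD⟩ : ∃ D : ℝ, D = ‖fderiv ℝ f ξ₀‖ := ⟨_, rfl⟩
  have hmax' : ∀ w : ℂ, ‖w‖ ≤ 1 → (1 - ‖w‖) * ‖fderiv ℝ f w‖ ≤ a * D := fun w hw => by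
    rw [ha, hD]
    exact hmax w (mem_closedBall_zero_iff.mpr hw)
  have hM0 : ‖fderiv ℝ f 0‖ ≤ a * D := by
    have := hmax' 0 (by simp)
    simpa using this
  have hMpos : 0 < a * D := (norm_pos_iff.mpr h0).trans_le hM0
  have ha0 : 0 ≤ a := by rw [ha]; linarith
  have hD0 : 0 ≤ D := by rw [hD]; exact norm_nonneg _
  have hapos : 0 < a := lt_of_le_of_ne ha0 fun h => by
    rw [← h, zero_mul] at hMpos
    exact lt_irrefl 0 hMpos
  have hDpos : 0 < D := lt_of_le_of_ne hD0 fun h => by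
    rw [← h, mul_zero] at hMpos
    exact lt_irrefl 0 hMpos
  have hξ₀1 : ‖ξ₀‖ < 1 := by
    rw [ha] at hapos
    linarith
  obtain ⟨ρ, hρ⟩ : ∃ ρ : ℝ, ρ = D⁻¹ := ⟨_, rfl⟩
  have hρpos : 0 < ρ := by rw [hρ]; exact inv_pos.mpr hDpos
  have hρD : ρ * D = 1 := by rw [hρ]; exact inv_mul_cancel₀ hDpos.ne'
  have hρM : ρ * (a * D / 2) = a / 2 := by
    rw [hρ]
    field_simp
  have hρM1 : ρ * (a * D) ≤ 1 :=
    calc ρ * (a * D) = a * (ρ * D) := by ring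
      _ = a := by rw [hρD, mul_one]
      _ ≤ 1 := by rw [ha]; linarith [norm_nonneg ξ₀]
  -- the disc `‖ζ‖ ≤ M / 2` is mapped into the disc `‖ξ‖ ≤ ‖ξ₀‖ + a / 2 = (1 + ‖ξ₀‖) / 2 < 1`
  have hw : ∀ ζ : ℂ, ‖ζ‖ ≤ a * D / 2 → ‖ξ₀ + ρ • ζ‖ ≤ ‖ξ₀‖ + a / 2 := fun ζ hζ => by
    calc ‖ξ₀ + ρ • ζ‖ ≤ ‖ξ₀‖ + ρ * ‖ζ‖ := Zalcman.norm_affine_le ξ₀ ζ hρpos.le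
      _ ≤ ‖ξ₀‖ + ρ * (a * D / 2) := by gcongr
      _ = ‖ξ₀‖ + a / 2 := by rw [hρM]
  have hw1 : ∀ ζ : ℂ, ‖ζ‖ ≤ a * D / 2 → ‖ξ₀ + ρ • ζ‖ ≤ 1 := fun ζ hζ => by
    have := hw ζ hζ
    linarith
  have hw2 : ∀ ζ : ℂ, ‖ζ‖ ≤ a * D / 2 → ‖ξ₀ + ρ • ζ‖ ≤ (1 + ‖ξ₀‖) / 2 := fun ζ hζ => by
    have := hw ζ hζ
    rw [ha] at this
    linarith
  refine ⟨ξ₀, ρ, a * D, hρpos, hξ₀1, hM0, hρM1, hw2, ?_, fun ζ hζ => ?_⟩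
  · -- `‖dg(0)‖ = ρ ‖df(ξ₀)‖ = 1`
    have h00 : ‖ξ₀ + ρ • (0 : ℂ)‖ ≤ 1 := by
      rw [smul_zero, add_zero]
      exact hξ₀1.le
    rw [GradBound.norm_fderiv_comp_affine (hdiff _ h00) hρpos.le, smul_zero, add_zero, ← hD, hρD]
  · -- `‖dg(ζ)‖ = ρ ‖df(ξ₀ + ρ ζ)‖ ≤ ρ · 2 D = 2` by maximality of `φ` at `ξ₀`
    rw [GradBound.norm_fderiv_comp_affine (hdiff _ (hw1 ζ hζ)) hρpos.le]
    have h1 := hmax' _ (hw1 ζ hζ)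
    have h2 : a / 2 ≤ 1 - ‖ξ₀ + ρ • ζ‖ := by
      have := hw ζ hζ
      linarith
    have h3 : a / 2 * ‖fderiv ℝ f (ξ₀ + ρ • ζ)‖ ≤ a / 2 * (2 * D) :=
      calc a / 2 * ‖fderiv ℝ f (ξ₀ + ρ • ζ)‖
          ≤ (1 - ‖ξ₀ + ρ • ζ‖) * ‖fderiv ℝ f (ξ₀ + ρ • ζ)‖ :=
            mul_le_mul_of_nonneg_right h2 (norm_nonneg _)
        _ ≤ a * D := h1
        _ = a / 2 * (2 * D) := by ring
    have h4 : ‖fderiv ℝ f (ξ₀ + ρ • ζ)‖ ≤ 2 * D := le_of_mul_le_mul_left h3 (half_pos hapos)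
    calc ρ * ‖fderiv ℝ f (ξ₀ + ρ • ζ)‖ ≤ ρ * (2 * D) := mul_le_mul_of_nonneg_left h4 hρpos.le
      _ = 2 := by rw [mul_left_comm, hρD, mul_one]

section Limits

variable {X E : Type*} [NormedAddCommGroup E]

/-- Finitely many individually bounded real functions on a set are uniformly bounded there. -/
theorem GradBound.exists_bound_head {S : Set X} (b : ℕ → X → ℝ)
    (hb : ∀ m, ∃ B : ℝ, ∀ x ∈ S, b m x ≤ B) (N : ℕ) :
    ∃ B : ℝ, ∀ m ≤ N, ∀ x ∈ S, b m x ≤ B := by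
  induction N with
  | zero =>
    obtain ⟨B, hB⟩ := hb 0
    exact ⟨B, fun m hm x hx => by rw [Nat.le_zero.mp hm]; exact hB x hx⟩
  | succ N ih =>
    obtain ⟨B, hB⟩ := ih
    obtain ⟨B', hB'⟩ := hb (N + 1)
    refine ⟨max B B', fun m hm x hx => ?_⟩
    rcases Nat.le_succ_iff.mp hm with h | h
    · exact (hB m h x hx).trans (le_max_left _ _)
    · rw [h]
      exact (hB' x hx).trans (le_max_right _ _)

/-- Functions continuous on a compact set and converging uniformly there are uniformly bounded
there (tail: uniform closeness to the continuous, hence bounded, limit; head: finitely many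
bounded functions). -/
theorem GradBound.exists_bound_of_tendstoUniformlyOn [TopologicalSpace X] {S : Set X}
    (hS : IsCompact S) {F : ℕ → X → E} {f : X → E} (hF : ∀ n, ContinuousOn (F n) S)
    (h : TendstoUniformlyOn F f atTop S) : ∃ R : ℝ, ∀ n, ∀ x ∈ S, ‖F n x‖ ≤ R := by
  have hf : ContinuousOn f S := h.continuousOn (Frequently.of_forall hF)
  obtain ⟨B, hB⟩ := hS.exists_bound_of_continuousOn hf
  obtain ⟨N, hN⟩ := eventually_atTop.mp ((Metric.tendstoUniformlyOn_iff.mp h) 1 one_pos)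
  obtain ⟨B', hB'⟩ := GradBound.exists_bound_head (fun n x => ‖F n x‖)
    (fun n => hS.exists_bound_of_continuousOn (hF n)) N
  refine ⟨max (B + 1) B', fun n x hx => ?_⟩
  rcases le_or_gt n N with hn | hn
  · exact (hB' n hn x hx).trans (le_max_right _ _)
  · have h1 : dist (F n x) (f x) ≤ 1 := by
      rw [dist_comm]
      exact (hN n hn.le x hx).le
    have h2 : ‖F n x‖ ≤ ‖f x‖ + 1 := norm_le_norm_add_const_of_dist_le h1
    exact (h2.trans (by linarith [hB x hx])).trans (le_max_left _ _)

/-- Reindexing a uniformly convergent sequence of functions along indices tending to infinity. -/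
theorem GradBound.tendstoUniformlyOn_comp [PseudoMetricSpace X] {Y : Type*} {S : Set Y}
    {F : ℕ → Y → X} {f : Y → X} (h : TendstoUniformlyOn F f atTop S) {n : ℕ → ℕ}
    (hn : Tendsto n atTop atTop) : TendstoUniformlyOn (fun j => F (n j)) f atTop S := by
  rw [Metric.tendstoUniformlyOn_iff] at h ⊢
  exact fun ε hε => hn.eventually (h ε hε)

/-- **Shrinking rescalings converge uniformly to a constant.** If `F k → v` uniformly on a compact
`S ⊆ ℂ` with `v` continuous on `S`, `q k → q⋆ ∈ S` and `t k → 0`, and the affine images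
`q k + t k • ζ`, `‖ζ‖ < 1`, stay in `S`, then `ζ ↦ F k (q k + t k • ζ)` converges to the constant
`v q⋆` uniformly on the open unit disc. -/
theorem GradBound.tendstoUniformlyOn_const {S : Set ℂ} (hS : IsCompact S) {F : ℕ → ℂ → E}
    {v : ℂ → E} (hv : ContinuousOn v S) (hF : TendstoUniformlyOn F v atTop S) {q : ℕ → ℂ}
    {qs : ℂ} (hq : Tendsto q atTop (𝓝 qs)) (hqs : qs ∈ S) {t : ℕ → ℝ}
    (ht : Tendsto t atTop (𝓝 0)) (hmem : ∀ k (ζ : ℂ), ‖ζ‖ < 1 → q k + t k • ζ ∈ S) :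
    TendstoUniformlyOn (fun k ζ => F k (q k + t k • ζ)) (fun _ => v qs) atTop (ball 0 1) := by
  rw [Metric.tendstoUniformlyOn_iff] at hF ⊢
  intro ε hε
  obtain ⟨η, hη, hvη⟩ := Metric.uniformContinuousOn_iff.mp
    (hS.uniformContinuousOn_of_continuous hv) (ε / 2) (half_pos hε)
  have h1 : Tendsto (fun k => dist (q k) qs + ‖t k‖) atTop (𝓝 0) := by
    have := (tendsto_iff_dist_tendsto_zero.mp hq).add (tendsto_zero_iff_norm_tendsto_zero.mp ht)
    simpa using this
  filter_upwards [hF (ε / 2) (half_pos hε), h1.eventually_lt_const hη] with k hk1 hk2 ζ hζ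
  rw [mem_ball_zero_iff] at hζ
  have hw : q k + t k • ζ ∈ S := hmem k ζ hζ
  have hdist : dist qs (q k + t k • ζ) < η := by
    have h3 : ‖t k‖ * ‖ζ‖ ≤ ‖t k‖ := mul_le_of_le_one_right (norm_nonneg _) hζ.le
    calc dist qs (q k + t k • ζ) ≤ dist qs (q k) + dist (q k) (q k + t k • ζ) :=
          dist_triangle _ _ _
      _ = dist (q k) qs + ‖t k‖ * ‖ζ‖ := by rw [dist_comm qs, dist_self_add_right, norm_smul]
      _ < η := by linarith
  calc dist (v qs) (F k (q k + t k • ζ))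
      ≤ dist (v qs) (v (q k + t k • ζ)) + dist (v (q k + t k • ζ)) (F k (q k + t k • ζ)) :=
        dist_triangle _ _ _
    _ < ε / 2 + ε / 2 := add_lt_add (hvη qs hqs _ hw hdist) (hk1 _ hw)
    _ = ε := add_halves ε

end Limits

end Summit.SmoothPoincare4.SmoothPoincare4.Theorems.WitnessCharge.PencilIncompleteness
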